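import Summits.NavierStokesRegularity.NavierStokesRegularity.Theorems.FrequencyRigidity.Negative.RSSWall
import Summits.NavierStokesRegularity.NavierStokesRegularity.Theorems.AdaptedFrequencyFrequencyRigidityKernelCompactness
import Summits.NavierStokesRegularity.NavierStokesRegularity.Theorems.AdaptedFrequencyFrequencyRigidityCoRotatingKernel
import Summits.NavierStokesRegularity.NavierStokesRegularity.Theorems.AdaptedFrequencyAdaptedKernelExists
import HarnessLib

/-!
# Crux `FrequencyRigidity` (stmt-NavierStokesRegularity-2955): THE WALL, now UNCONDITIONAL —
# `FrequencyRigidity → ∀ α, RSSLiouvilleBounded α`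

Helper file (lands `--supports stmt-NavierStokesRegularity-2955`; theorems only).  The refuter's wall
`Negative/RSSWall.lean` (p84263) proves `CoRotatingKernelHypothesis α → FrequencyRigidity → RSSLiouvilleBounded α`
for every angular speed `α`, with the kernel hypothesis H(α) CARRIED.  This file DISCHARGES H(α) for every `α`
from three landed theorems:

* `stub_kernelCompactness` (S4, p108781; `…KernelCompactness.lean`) — adapted kernels of one drift between two
  fixed Gaussians are compact;
* `linearTypeIDriftKernel` (crux AdaptedKernelExists, `…AdaptedKernelExists.lean`) — every smooth divergence-free
  Type-I drift on a slab carries adapted kernels between Gaussians depending on `(ν, C)` only — whence, by S4,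
  ANCIENT kernels on `(−∞,0)` (`ancientKernel`, the glue `ancientKernel_of_compactness` of the planner's skeleton of
  line `moving-adjoint-bernoulli`, reproduced here against the landed S4);
* `stub_coRotatingKernel` (S5, p118450; `…CoRotatingKernel.lean`) — from S4 and ancient kernels, a CO-ROTATING
  adapted comparable kernel for every RSS drift (discrete screw-averaging + compactness twice + dyadic density).

Conclusions: `coRotatingKernelHypothesis_holds : ∀ α, Negative.CoRotatingKernelHypothesis α` and the unconditional
wall `rssWall_unconditional : FrequencyRigidity → ∀ α, Negative.RSSLiouvilleBounded α`.  So any proof of the crux —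
equivalently of Stub 3 / S3L of line `two-ended-pinning` — proves the bounded-profile rotated-self-similar Liouville
theorem for EVERY `α` (Pineau–Vicol 2026 Conj. 1.1 on its open window included), with no remaining hypothesis.
Together with `…OfLiouville.lean` (p107437): `LiouvilleConjectureNS ⇒ FrequencyRigidity ⇒ ∀ α RSSLiouvilleBounded α`,
all arrows checked.  Nothing here asserts a route statement; no `¬`-theorem is claimed.

## References

* B. Pineau, V. Vicol, arXiv:2607.09619 (2026), Conjecture 1.1, Theorem 1.4. [PineauVicol2026]
* Z. Bradshaw, T.-P. Tsai, Comm. PDE 42 (2017), §5, Open Problem 5.2. [BradshawTsai2017CPDE]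
* G. Koch, N. Nadirashvili, G. Seregin, V. Šverák, Acta Math. 203 (2009) 83–105, §1. [KochNadirashviliSereginSverak2009]
-/

set_option linter.dupNamespace false

noncomputable section

namespace Summit.NavierStokesRegularity.NavierStokesRegularity.Theorems.FrequencyRigidity.MovingAdjointBernoulli

open Literature.Analysis Literature.Analysis.FluidPDE MeasureTheory Set Filter Topology Function

/-- **Ancient adapted kernels for Type-I drifts, constants depending on `(ν, C)` only** — from kernel
compactness (S4, landed) and the landed linear theorem `linearTypeIDriftKernel` of crux AdaptedKernelExists
(kernels on the windows `[−n−1, 0)` with uniform two-sided Gaussian bounds; S4 passes to the limit `n → ∞`).  This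
is the glue `ancientKernel_of_compactness` of the planner's skeleton `Lines/moving_adjoint_bernoulli.lean`, now
unconditional. [cite: KochNadirashviliSereginSverak2009, §1] -/
theorem ancientKernel :
    ∀ (ν C : ℝ), 0 < ν → 0 ≤ C → ∃ c₁ c₂ C₁ C₂ : ℝ, 0 < c₁ ∧ 0 < c₂ ∧ 0 < C₁ ∧ 0 < C₂ ∧
      ∀ (v : ℝ → EuclideanSpace ℝ (Fin 3) → EuclideanSpace ℝ (Fin 3)),
        Literature.Analysis.FluidPDE.IsSmoothSpaceTimeOn (Set.Iio 0) v →
        (∀ t ∈ Set.Iio (0:ℝ), Literature.Analysis.FluidPDE.VectorCalculus.IsDivFree (v t)) →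
        Literature.Analysis.FluidPDE.HasTypeITimeDecay C v →
        ∃ G : ℝ → EuclideanSpace ℝ (Fin 3) → ℝ, Literature.Analysis.FluidPDE.IsAdaptedBackwardKernel ν v (Set.Iio 0) 0 0 G ∧
          ∀ t ∈ Set.Iio (0:ℝ), ∀ x,
            c₁ * ((0:ℝ) - t) ^ (-(3:ℝ) / 2) * Real.exp (-(‖x - (0 : EuclideanSpace ℝ (Fin 3))‖ ^ 2) / (c₂ * ((0:ℝ) - t))) ≤ G t x ∧
            G t x ≤ C₁ * ((0:ℝ) - t) ^ (-(3:ℝ) / 2) * Real.exp (-(‖x - (0 : EuclideanSpace ℝ (Fin 3))‖ ^ 2) / (C₂ * ((0:ℝ) - t))) := by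
  intro ν C hν hC
  obtain ⟨c₁, c₂, C₁, C₂, hc₁, hc₂, hC₁, hC₂, hwin⟩ := linearTypeIDriftKernel ν C hν hC
  refine ⟨c₁, c₂, C₁, C₂, hc₁, hc₂, hC₁, hC₂, fun v hsm hdiv hTI => ?_⟩
  -- kernels on the windows `Ico (−n−1) 0`
  have hK : ∀ n : ℕ, ∃ Kn : ℝ → EuclideanSpace ℝ (Fin 3) → ℝ,
      IsAdaptedBackwardKernel ν v (Ico (-(n:ℝ) - 1) 0) 0 0 Kn ∧
      (∀ t ∈ Ico (-(n:ℝ) - 1) (0:ℝ), ∀ x,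
        c₁ * ((0:ℝ) - t) ^ (-(3:ℝ) / 2) *
            Real.exp (-(‖x - (0 : EuclideanSpace ℝ (Fin 3))‖ ^ 2) / (c₂ * ((0:ℝ) - t))) ≤ Kn t x ∧
        Kn t x ≤ C₁ * ((0:ℝ) - t) ^ (-(3:ℝ) / 2) *
            Real.exp (-(‖x - (0 : EuclideanSpace ℝ (Fin 3))‖ ^ 2) / (C₂ * ((0:ℝ) - t)))) := by
    intro n
    have htb : (-(n:ℝ) - 2) < (-(n:ℝ) - 1) := by linarith
    have ht₀ : (-(n:ℝ) - 1) < (0:ℝ) := by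
      have : (0:ℝ) ≤ n := Nat.cast_nonneg n
      linarith
    have hsub : Ico (-(n:ℝ) - 2) (0:ℝ) ⊆ Iio 0 := fun t ht => ht.2
    have hsm' : IsSmoothSpaceTimeOn (Ico (-(n:ℝ) - 2) 0) v := hsm.mono hsub
    have hdiv' : ∀ t ∈ Ico (-(n:ℝ) - 2) (0:ℝ), VectorCalculus.IsDivFree (v t) :=
      fun t ht => hdiv t (hsub ht)
    have hrate : ∀ t ∈ Ico (-(n:ℝ) - 2) (0:ℝ), ∀ x, ‖v t x‖ ≤ C / Real.sqrt (0 - t) := by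
      intro t ht x
      have := hTI t ht.2 x
      simpa using this
    obtain ⟨G, hG, hlo, hhi⟩ := hwin (-(n:ℝ) - 2) (-(n:ℝ) - 1) 0 v 0 htb ht₀ hsm' hdiv' hrate
    exact ⟨G, hG, fun t ht x => ⟨hlo t ht x, hhi t ht x⟩⟩
  choose K hK using hK
  have hloc : ∀ a b : ℝ, a < b → b < 0 → ∃ B : ℝ, ∀ t ∈ Icc a b, ∀ x, ‖v t x‖ ≤ B := by
    intro a b hab hb
    refine ⟨C / Real.sqrt (-b), fun t ht x => (hTI t (lt_of_le_of_lt ht.2 hb) x).trans ?_⟩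
    exact div_le_div_of_nonneg_left hC (Real.sqrt_pos.2 (by linarith))
      (Real.sqrt_le_sqrt (by linarith [ht.2]))
  obtain ⟨G, φ, -, hG, hGb, -⟩ :=
    stub_kernelCompactness ν c₁ c₂ C₁ C₂ v K hν hc₁ hc₂ hC₁ hC₂ hsm hdiv hloc (fun n => hK n)
  exact ⟨G, hG, hGb⟩

/-- **H(α) holds for every `α`** (registered sub-goal `coRotatingKernelHypothesis_holds`): every smooth
bounded-gradient profile whose RSS field is a classical Navier–Stokes flow on `(−∞,0)` admits an adapted
Gaussian-comparable kernel at `(0,0)` of co-rotating self-similar form — S5 (landed) fed with S4 (landed) and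
`ancientKernel`. [cite: PineauVicol2026, §1.2 (1.7)–(1.10)] -/
theorem coRotatingKernelHypothesis_holds :
    ∀ α : ℝ, Summit.NavierStokesRegularity.NavierStokesRegularity.Theorems.FrequencyRigidity.Negative.CoRotatingKernelHypothesis α :=
  stub_coRotatingKernel stub_kernelCompactness ancientKernel

/-- **THE WALL, UNCONDITIONAL** (registered sub-goal `rssWall_unconditional`): the crux `FrequencyRigidity`
implies the bounded-profile rotated-self-similar Liouville theorem `RSSLiouvilleBounded α` for EVERY angular speed
`α` — `α = 0` is Tsai's theorem (`Negative.rssLiouvilleBounded_zero`), `α ≠ 0` contains Pineau–Vicol 2026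
Conjecture 1.1 (= Bradshaw–Tsai 2017 OP 5.2) in the bounded-gradient class, OPEN.  (The refuter's
`Negative.rssLiouvilleBounded_of_frequencyRigidity` with its kernel hypothesis discharged by
`coRotatingKernelHypothesis_holds`.) [cite: BradshawTsai2017CPDE, §5 OP 5.2; PineauVicol2026, Conj. 1.1] -/
theorem rssWall_unconditional :
    Summit.NavierStokesRegularity.NavierStokesRegularity.Theses.AdaptedFrequency.FrequencyRigidity → ∀ α : ℝ, Summit.NavierStokesRegularity.NavierStokesRegularity.Theorems.FrequencyRigidity.Negative.RSSLiouvilleBounded α :=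
  fun hFR α => Negative.rssLiouvilleBounded_of_frequencyRigidity (coRotatingKernelHypothesis_holds α) hFR

end Summit.NavierStokesRegularity.NavierStokesRegularity.Theorems.FrequencyRigidity.MovingAdjointBernoulli

end
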